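import Summits.SmoothPoincare4.SmoothPoincare4.Theses.SchoenfliesSplit
import Literature.Topology.FourManifolds.ClosedBallProofs

/-!
# `SchsplitCerf` without the COVER clause is false (negative lemma, crux stmt-SmoothPoincare4-8758)

`SchoenfliesSplit.SchsplitCerf` (= `cerf_twistedSphere_four`) concludes `P ≅ S⁴` for every compact
smooth 4-manifold `P` which is the closed gluing `D⁴ ∪_φ D⁴`: two smooth disc embeddings
`jA jB : D⁴ ↪ P` with (i) `range jA ∪ range jB = univ` and (ii) `jA a = jB b ↔ a = ι z, b = ι (φ z)`.
Deleting the COVER clause (i) — keeping compactness, both smooth embeddings and the seam relation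
(ii) — is refuted by the disconnected witness `S⁴ ⊔ S⁴`: the two hemispheres of the first summand
(the tree's proved double structure `isDouble_sphere_holds`, pushed through `Sum.inl`) satisfy (ii)
for `φ = id`, and `S⁴ ⊔ S⁴ ≇ S⁴` (connectedness).  Inside a connected `P` clause (i) is automatic
(the union of the two discs is a closed 4-manifold, open in `P` by invariance of domain), so (i) is
exactly "`P` is connected"; cdisprove seat.

On the way: `Sum.inl ∘ f` is a smooth embedding whenever `f` is (`isSmoothEmbedding_inl_comp`), the
special case of Mathlib's `proof_wanted Manifold.IsSmoothEmbedding.comp` needed here, via lifting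
maximal-atlas charts along `Sum.inl` (`mem_maximalAtlas_lift_inl`).
-/

noncomputable section

-- the prescribed namespace `Summit.<P>.<Sub>.…` duplicates `SmoothPoincare4` (P = Sub)
set_option linter.dupNamespace false

open scoped Manifold ContDiff Topology
open Set Function

namespace Summit.SmoothPoincare4.SmoothPoincare4.Theorems.SchsplitCerf.Negative

open Literature.Topology.FourManifolds

/-! ### Smooth embeddings into a disjoint union -/

section SumEmbedding

universe u

variable {EM : Type*} [NormedAddCommGroup EM] [NormedSpace ℝ EM] {HM : Type*}
  [TopologicalSpace HM] {I : ModelWithCorners ℝ EM HM}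
  {EN : Type u} [NormedAddCommGroup EN] [NormedSpace ℝ EN] {HN : Type*} [TopologicalSpace HN]
  {J : ModelWithCorners ℝ EN HN}
  {M : Type*} [TopologicalSpace M] [ChartedSpace HM M]
  {N N' : Type*} [TopologicalSpace N] [ChartedSpace HN N] [TopologicalSpace N']
  [ChartedSpace HN N'] {n : ℕ∞ω}

/-- A chart of the maximal `C^n` atlas of `N`, lifted along `Sum.inl`, lies in the maximal atlas of
`N ⊕ N'` (Mathlib's `IsManifold.disjointUnion` proves this for charts of the atlas only).
[folklore] -/
theorem mem_maximalAtlas_lift_inl [Nonempty HN] [IsManifold J n N] [IsManifold J n N']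
    {e : OpenPartialHomeomorph N HN} (he : e ∈ IsManifold.maximalAtlas J n N) :
    e.lift_openEmbedding (X' := N ⊕ N') Topology.IsOpenEmbedding.inl ∈
      IsManifold.maximalAtlas J n (N ⊕ N') := by
  rw [IsManifold.mem_maximalAtlas_iff, mem_maximalAtlas_iff]
  intro e' he'
  obtain (⟨f, hf, rfl⟩ | ⟨f, hf, rfl⟩) := ChartedSpace.mem_atlas_sum he'
  · rw [e.lift_openEmbedding_trans f Topology.IsOpenEmbedding.inl,
      f.lift_openEmbedding_trans e Topology.IsOpenEmbedding.inl]
    exact ⟨IsManifold.compatible_of_mem_maximalAtlas he (IsManifold.subset_maximalAtlas hf),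
      IsManifold.compatible_of_mem_maximalAtlas (IsManifold.subset_maximalAtlas hf) he⟩
  · constructor
    · apply ContDiffGroupoid.mem_of_source_eq_empty
      ext x
      exact ⟨fun ⟨hx₁, hx₂⟩ => by simp_all, fun hx => hx.elim⟩
    · apply ContDiffGroupoid.mem_of_source_eq_empty
      ext x
      exact ⟨fun ⟨hx₁, hx₂⟩ => by simp_all, fun hx => hx.elim⟩

/-- **Post-composition of an immersion (with chosen complement) with `Sum.inl`**: keep the domain
chart and the linear normal form, lift the codomain chart along the open embedding `Sum.inl`.
[folklore] -/
theorem isImmersionAtOfComplement_inl_comp [Nonempty HN] [IsManifold J n N] [IsManifold J n N']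
    {F : Type*} [NormedAddCommGroup F] [NormedSpace ℝ F] {f : M → N} {x : M}
    (h : Manifold.IsImmersionAtOfComplement F I J n f x) :
    Manifold.IsImmersionAtOfComplement F I J n (Sum.inl ∘ f : M → N ⊕ N') x := by
  refine Manifold.IsImmersionAtOfComplement.mk_of_charts h.equiv h.domChart
    (h.codChart.lift_openEmbedding Topology.IsOpenEmbedding.inl) h.mem_domChart_source
    ⟨f x, h.mem_codChart_source, rfl⟩ h.domChart_mem_maximalAtlas
    (mem_maximalAtlas_lift_inl h.codChart_mem_maximalAtlas)
    (fun y hy => ⟨f y, h.source_subset_preimage_source hy, rfl⟩) ?_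
  intro u hu
  have key := h.writtenInCharts hu
  simp only [Function.comp_apply, OpenPartialHomeomorph.extend_coe] at key ⊢
  rw [OpenPartialHomeomorph.lift_openEmbedding_apply]
  exact key

/-- **A smooth embedding followed by `Sum.inl` is a smooth embedding** into the disjoint union
(special case of Mathlib's `proof_wanted Manifold.IsSmoothEmbedding.comp`). [folklore] -/
theorem isSmoothEmbedding_inl_comp [Nonempty HN] [IsManifold J n N] [IsManifold J n N']
    {f : M → N} (h : Manifold.IsSmoothEmbedding I J n f) :
    Manifold.IsSmoothEmbedding I J n (Sum.inl ∘ f : M → N ⊕ N') := by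
  obtain ⟨⟨F, _, _, hF⟩, hemb⟩ := h
  exact ⟨⟨F, _, _, fun x => isImmersionAtOfComplement_inl_comp (hF x)⟩,
    Topology.IsEmbedding.inl.comp hemb⟩

end SumEmbedding

/-! ### The witness `S⁴ ⊔ S⁴` -/

/-- `S⁴ ⊔ S⁴` is not diffeomorphic (not even homeomorphic) to `S⁴`: the sphere is connected, the
disjoint union is not. [folklore] -/
theorem isEmpty_diffeomorph_sum_sphere_four :
    IsEmpty (((Metric.sphere (0 : EuclideanSpace ℝ (Fin 5)) 1) ⊕
        (Metric.sphere (0 : EuclideanSpace ℝ (Fin 5)) 1)) ≃ₘ⟮𝓡 4, 𝓡 4⟯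
      (Metric.sphere (0 : EuclideanSpace ℝ (Fin 5)) 1)) := by
  refine ⟨fun e => ?_⟩
  have hrank : 1 < Module.rank ℝ (EuclideanSpace ℝ (Fin 5)) := by
    rw [← Module.finrank_eq_rank, finrank_euclideanSpace_fin]
    exact_mod_cast (by norm_num : (1 : ℕ) < 5)
  haveI : PreconnectedSpace (Metric.sphere (0 : EuclideanSpace ℝ (Fin 5)) 1) :=
    Subtype.preconnectedSpace (isPreconnected_sphere hrank (0 : EuclideanSpace ℝ (Fin 5)) 1)
  have hpre : IsPreconnected (univ : Set ((Metric.sphere (0 : EuclideanSpace ℝ (Fin 5)) 1) ⊕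
      (Metric.sphere (0 : EuclideanSpace ℝ (Fin 5)) 1))) := by
    have himg := (isPreconnected_univ (α := Metric.sphere (0 : EuclideanSpace ℝ (Fin 5)) 1)).image
      e.toHomeomorph.symm e.toHomeomorph.symm.continuous.continuousOn
    rwa [image_univ, EquivLike.range_eq_univ] at himg
  haveI : PreconnectedSpace ((Metric.sphere (0 : EuclideanSpace ℝ (Fin 5)) 1) ⊕
      (Metric.sphere (0 : EuclideanSpace ℝ (Fin 5)) 1)) := ⟨hpre⟩
  have p : Metric.sphere (0 : EuclideanSpace ℝ (Fin 5)) 1 := ⟨EuclideanSpace.single 0 1, by simp⟩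
  have huniv : range (Sum.inl : (Metric.sphere (0 : EuclideanSpace ℝ (Fin 5)) 1) →
      (Metric.sphere (0 : EuclideanSpace ℝ (Fin 5)) 1) ⊕
        (Metric.sphere (0 : EuclideanSpace ℝ (Fin 5)) 1)) = univ :=
    isClopen_range_inl.eq_univ ⟨Sum.inl p, p, rfl⟩
  have hmem : (Sum.inr p : (Metric.sphere (0 : EuclideanSpace ℝ (Fin 5)) 1) ⊕
      (Metric.sphere (0 : EuclideanSpace ℝ (Fin 5)) 1)) ∈
        range (Sum.inl : (Metric.sphere (0 : EuclideanSpace ℝ (Fin 5)) 1) → _) := by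
    rw [huniv]; exact mem_univ _
  obtain ⟨q, hq⟩ := hmem
  exact Sum.inl_ne_inr hq

/-- **`SchsplitCerf` minus the cover clause is false.**  The displayed statement is the crux with
`IsClosedGluing`'s clause `range jA ∪ range jB = univ` deleted and everything else kept (the
`TwistedSphere` binders, both smooth disc embeddings `(𝓡∂ 4) → (𝓡 4)`, the seam relation along
`φ`); witness `P = S⁴ ⊔ S⁴`, `φ = id`, `jA, jB` = the two hemispheres of the first summand.
So any proof of the crux must use the cover clause (equivalently: connectedness of `P`). [folklore] -/
theorem schsplitCerf_false_without_cover :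
    ¬ ∀ (φ : (Metric.sphere (0 : EuclideanSpace ℝ (Fin 4)) 1) ≃ₘ⟮𝓡 3, 𝓡 3⟯
          (Metric.sphere (0 : EuclideanSpace ℝ (Fin 4)) 1))
        (P : Type) [TopologicalSpace P] [T2Space P] [SecondCountableTopology P] [CompactSpace P]
        [ChartedSpace (EuclideanSpace ℝ (Fin 4)) P] [IsManifold (𝓡 4) ∞ P],
        (∃ jA jB : (Metric.closedBall (0 : EuclideanSpace ℝ (Fin 4)) 1) → P,
          Manifold.IsSmoothEmbedding (𝓡∂ 4) (𝓡 4) ∞ jA ∧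
          Manifold.IsSmoothEmbedding (𝓡∂ 4) (𝓡 4) ∞ jB ∧
          ∀ a b, jA a = jB b ↔ ∃ z, a = (closedBallBoundaryData 3).incl z ∧
            b = (closedBallBoundaryData 3).incl (φ z)) →
        Nonempty (P ≃ₘ⟮𝓡 4, 𝓡 4⟯ (Metric.sphere (0 : EuclideanSpace ℝ (Fin 5)) 1)) := by
  intro h
  obtain ⟨jA, jB, hA, hB, -, hR⟩ :=
    (isTwistedSphere_refl_sphere (isDouble_sphere_holds (n := 3)) :
      IsTwistedSphere 3 (Diffeomorph.refl (𝓡 3) (Metric.sphere (0 : EuclideanSpace ℝ (Fin 4)) 1) ∞)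
        (Metric.sphere (0 : EuclideanSpace ℝ (Fin 5)) 1))
  obtain ⟨e⟩ := h (Diffeomorph.refl (𝓡 3) _ ∞)
    ((Metric.sphere (0 : EuclideanSpace ℝ (Fin 5)) 1) ⊕ (Metric.sphere (0 : EuclideanSpace ℝ (Fin 5)) 1))
    ⟨Sum.inl ∘ jA, Sum.inl ∘ jB, isSmoothEmbedding_inl_comp hA, isSmoothEmbedding_inl_comp hB,
      fun a b => by
        rw [Function.comp_apply, Function.comp_apply, Sum.inl_injective.eq_iff]
        exact hR a b⟩
  exact isEmpty_diffeomorph_sum_sphere_four.false e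

end Summit.SmoothPoincare4.SmoothPoincare4.Theorems.SchsplitCerf.Negative

end
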